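import Literature.NumberTheory.ComplexMultiplication.PrimitiveCMTypeGaloisClassesBound
import Literature.NumberTheory.ComplexMultiplication.CMTori
import Literature.AlgebraicGeometry.Pohlmann1968.NondegenerateCMTypeHodgeConjecture
import HarnessLib

/-!
# The rank of a CM type is an invariant of its GALOIS class, and Ribet's §3 inequalities in the complex model:
# `⌈log₂ 2[K* : ℚ]⌉ ≤ Rank(Φ) ≤ [K* : ℚ]/2 + 1` (Ribet 1980 (3.4)–(3.5)), `p + 1 ≤ Rank` for odd `p ∣ [K* : ℚ]` (Dodson
# 1987 Thm. 1.4), Cor. (3.6); hence `Rank = 2 ⟺ [K* : ℚ] = 2`, `Rank = 3 ⟺ [K* : ℚ] = 4`, `[K* : ℚ] = 6 ⟹ Rank = 4`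

Layer `Literature/NumberTheory/ComplexMultiplication`, namespace `Literature.NumberTheory.ComplexMultiplication` (lane
`lit-hodgefound`, Track 2 foundations, Layer A3; seat `lit-hodgefound-p11`, generation 25, row g25-#5).  Sequel of
`CMTypeGaloisClassReflexDegree` (g24-#6: the Galois class of `Φ` has `[K* : ℚ] = [ℚ(tr_Φ) : ℚ]` members),
`CMTypeQuadraticReflexField` (g25-#3: `[K* : ℚ] = 2 ⟺` induced from an imaginary quadratic subfield; `= 4 ⟺` quartic
core) and `PrimitiveCMTypeGaloisClassesBound` (g25-#4: octic reflex degrees), on the tree's rank files: `CMTypeRank`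
(`typeRank G Φ = dim_ℚ ⟨𝟙_{g⁻¹Φ}⟩`, Kubota–Dodson), `CMTori` (`IsCMTypeWith.typeRank_le_card_orbit`, Ribet (3.4) at group
level), `ReflexDegreeRankBounds` (Ribet (3.5), Dodson Thms. 1.4 / 1.12 and Cor. (3.6), Galois-side for
`reflexField ℚ L Φ_L`), `Pohlmann1968.NondegenerateCMTypeDivisorClasses` (`cmTypeRank`, `IsNondegenerate`, `cmTypeRank_le`)
and `…NondegenerateCMTypeHodgeConjecture` (Yanai: primitive of prime dimension ⟹ nondegenerate).  THEOREMS ONLY; no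
definition, no named fact (D-0026).

THE PRINT.  K. Ribet, *Division fields of abelian varieties with complex multiplication* (1980), §3 (pp. 85–87):
(3.1) «`[K : ℚ] = (G : H′) ≤ 2ᵈ`»; Prop. (3.3) «The rank of a CM type `(E, S)` is equal to the rank of its dual»;
(3.4) «`rank(E, S) ≤ min(d + 1, d′ + 1)`»; (3.5) «`max(2 + Log d, 2 + Log d′) ≤ rank(E, S)`»; Cor. (3.6) «Suppose
that we have `d′ = 2ᵈ⁻¹`. Then `(E, S)` is non-degenerate».  B. Dodson, J. Algebra 111 (1987), §1.1 (p. 50): «the rank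
`t` of `(K, Φ)` is defined to be the rank over `ℤ` of the submodule spanned by `{Φᵍ such that g ∈ Gal(Kᶜ/ℚ)}`» — so it
depends only on the `Gal`-orbit of `Φ` —; Thm. 1.4 (Ribet): «Let `p` be an odd prime dividing `n`. Then `B(n) ≥ p + 1`»;
Thm. 1.0 (ii) `t ≤ n + 1`.  H. Yanai (1985) §4: a simple CM type of prime dimension is nondegenerate.

WHAT IS PROVED.
* §1 (group level, `G` acting on `E`, `a ∈ G`, `Φ ⊆ E`): `translateInd_smul_set` (`𝟙_{g⁻¹(aΦ)} = 𝟙_{(a⁻¹g)⁻¹Φ}`),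
  `range_translateInd_smul_set`, **`typeRank_smul` (`rank(aΦ) = rank(Φ)`: the translates of `aΦ` are the translates
  of `Φ`)**.
* §2 (`K` a CM field, `Φ : CMType K`): **`cmTypeRank_cmTypeSmul` (`Rank(τΦ) = Rank(Φ)`)**, `cmTypeRank_eq_of_galoisRel`,
  `isNondegenerate_cmTypeSmul_iff`, `isNondegenerate_iff_of_galoisRel`, `cmTypeRank_cmTypeSmul_twist` (invariance under
  DIS's combined equivalence), and the Mumford–Tate Lie algebra `mumfordTateLieAlgebra_ofCMType_eq_of_galoisRel` (tree
  `mumfordTateLieAlgebra_ofCMType_cmTypeSmul` in setoid form).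
* §3 Ribet §3 in `ℂ` (`K* = ℚ(tr_Φ)`): `natCard_orbit_eq_finrank_traceField` (`#(Aut(ℂ)·Φ) = [K* : ℚ]`),
  **`cmTypeRank_le_finrank_traceField_div_two_add_one` ((3.4): `Rank ≤ [K* : ℚ]/2 + 1`)**,
  **`two_mul_finrank_traceField_le_two_pow_cmTypeRank` ((3.5): `2[K* : ℚ] ≤ 2^{Rank}`)**, `clog_…`, `two_le_cmTypeRank_complex`,
  `add_one_le_cmTypeRank_of_prime_dvd_finrank_traceField` (Dodson Thm. 1.4 through the reflex),
  `two_mul_le_cmTypeRank_of_prime_sq_dvd_finrank_traceField` (Thm. 1.12), **`isNondegenerate_of_finrank_traceField_eq_two_pow`**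
  (Cor. (3.6)).
* §4 consequences: **`cmTypeRank_eq_two_iff_finrank_traceField_eq_two`** (`Rank = 2 ⟺ [K* : ℚ] = 2 ⟺` induced from an
  imaginary quadratic subfield, `cmTypeRank_eq_two_iff_exists_inducedCMType_quadratic`),
  **`cmTypeRank_eq_three_iff_finrank_traceField_eq_four`** (`Rank = 3 ⟺ [K* : ℚ] = 4 ⟺` quartic primitive core),
  **`cmTypeRank_eq_four_of_finrank_traceField_eq_six`**, `five_le_cmTypeRank_of_finrank_traceField_eq_twelve`,
  `three_le_cmTypeRank_of_isPrimitive` (`[K : ℚ] ≥ 4`).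
* §5 degree instances: sextic — `cmTypeRank_eq_two_or_four_of_finrank_eq_six`, `cmTypeRank_eq_four_iff_isPrimitive_sextic`
  (`⟺ [K* : ℚ] ≥ 6`); octic — `isNondegenerate_of_finrank_traceField_eq_twelve_octic` (reflex degree `12` or `16` ⟹
  nondegenerate), `cmTypeRank_octic_of_finrank_traceField` (`2 ↦ 2`, `4 ↦ 3`, `6 ↦ 4`, `12, 16 ↦ 5`); decic —
  `cmTypeRank_eq_two_or_six_of_finrank_eq_ten`.

## References

* [Ribet1980] K. A. Ribet, Mém. SMF (2) 2 (1980), §3 (3.1), Prop. (3.3), (3.4), (3.5), Cor. (3.6) (pp. 85–87).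
* [Dodson1987] B. Dodson, *On the Mumford–Tate group of an abelian variety with complex multiplication*, J. Algebra 111
  (1987), §1.1 (p. 50), Thm. 1.0 (ii), Thm. 1.4, Thm. 1.12.
* [Yanai1985] H. Yanai, *On the rank of CM-type*, Nagoya Math. J. 97 (1985), §4 Theorem.
* [Shimura1998] G. Shimura (1998), §8.3 Prop. 28, §32.10.
* [DinaIonicaSijsling2022] B. Dina, S. Ionica, J. Sijsling (2022), §1.2 Def. 8, Rem. 14.
* [Deligne1982HodgeCycles] P. Deligne, *Hodge cycles on abelian varieties* (1982), Example 3.7.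

## Provenance

Lane `lit-hodgefound` (HOME `run/shared/lean/pub/lit-hodgefound/`), prover seat `lit-hodgefound-p11` (gen 25),
self-proposed row g25-#5 (INBOX claim 2026-08-27, l.40752).
-/

set_option autoImplicit false

noncomputable section

open scoped Classical NumberField Pointwise
open NumberField Module IntermediateField

namespace Literature.NumberTheory.ComplexMultiplication

/-! ## §1 Group level: the rank of `aΦ` is the rank of `Φ` -/

section GroupLevel

variable {G : Type*} [Group G] {E : Type*} [MulAction G E]

/-- `𝟙[g • x ∈ aΦ] = 𝟙[(a⁻¹g) • x ∈ Φ]`: the translates of `aΦ` are translates of `Φ`. [cite: Dodson1987, §1.1 (p. 50)] -/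
theorem translateInd_smul_set (a g : G) (Φ : Set E) : translateInd (a • Φ) g = translateInd Φ (a⁻¹ * g) := by
  funext x
  simp only [translateInd, Set.mem_smul_set_iff_inv_smul_mem, mul_smul]

/-- The set of translates `{𝟙_{g⁻¹(aΦ)}}_g` is the set `{𝟙_{g⁻¹Φ}}_g`. [cite: Dodson1987, §1.1 (p. 50)] -/
theorem range_translateInd_smul_set (a : G) (Φ : Set E) :
    Set.range (fun g : G => translateInd (a • Φ) g) = Set.range (fun g : G => translateInd Φ g) := by
  ext f
  simp only [Set.mem_range, translateInd_smul_set]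
  constructor
  · rintro ⟨g, rfl⟩
    exact ⟨a⁻¹ * g, rfl⟩
  · rintro ⟨g, rfl⟩
    exact ⟨a * g, by rw [inv_mul_cancel_left]⟩

/-- **`rank(aΦ) = rank(Φ)`** — the rank is «the rank over `ℤ` of the submodule spanned by `{Φᵍ such that g ∈ Gal}`», a
function of the orbit of `Φ` only. [cite: Dodson1987, §1.1 (p. 50)] -/
theorem typeRank_smul (a : G) (Φ : Set E) : typeRank G (a • Φ) = typeRank G Φ := by
  rw [typeRank_eq_finrank_translateSpan, typeRank_eq_finrank_translateSpan, translateSpan, translateSpan,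
    range_translateInd_smul_set]

end GroupLevel

/-! ## §2 Complex CM types: `Rank(τΦ) = Rank(Φ)`, nondegeneracy and `𝔪𝔱` along a Galois class -/

section Complex

open Literature.AlgebraicGeometry.Motives (CMType)
open Literature.AlgebraicGeometry.Motives.HodgeStructure (cmTypeSmul cmTypeSmul_val)
open Literature.AlgebraicGeometry.Pohlmann1968 (cmTypeRank IsNondegenerate isNondegenerate_iff cmTypeRank_le
  isCMTypeWith_conj isPretransitive_ringEquiv_complex)

variable {K : Type} [Field K] [NumberField K] [IsCMField K]

/-- **`Rank(τΦ) = Rank(Φ)` for `τ ∈ Aut(ℂ)`** (Dodson's `Φᵍ`: the rank is an invariant of the Galois class).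
[cite: Dodson1987, §1.1 (p. 50)] [cite: DinaIonicaSijsling2022, §1.2 Def. 8] -/
theorem cmTypeRank_cmTypeSmul (τ : ℂ ≃+* ℂ) (Φ : CMType K) : cmTypeRank (cmTypeSmul τ Φ) = cmTypeRank Φ := by
  change typeRank (ℂ ≃+* ℂ) (cmTypeSmul τ Φ).1 = typeRank (ℂ ≃+* ℂ) Φ.1
  rw [cmTypeSmul_val, typeRank_smul]

/-- Galois-equivalent CM types have the same rank. [cite: Dodson1987, §1.1 (p. 50)] [cite: DinaIonicaSijsling2022, §1.2 Def. 8] -/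
theorem cmTypeRank_eq_of_galoisRel {Φ Ψ : CMType K} (h : (cmTypeGaloisSetoid K).r Φ Ψ) : cmTypeRank Ψ = cmTypeRank Φ := by
  obtain ⟨τ, rfl⟩ := h
  exact cmTypeRank_cmTypeSmul τ Φ

/-- `τΦ` is nondegenerate iff `Φ` is. [cite: Dodson1987, §1.1 (p. 50) and Thm. 1.0] -/
theorem isNondegenerate_cmTypeSmul_iff (τ : ℂ ≃+* ℂ) (Φ : CMType K) :
    IsNondegenerate (cmTypeSmul τ Φ) ↔ IsNondegenerate Φ := by
  rw [isNondegenerate_iff, isNondegenerate_iff, cmTypeRank_cmTypeSmul]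

/-- Nondegeneracy is an invariant of the Galois class. [cite: Dodson1987, §1.1 (p. 50) and Thm. 1.0] -/
theorem isNondegenerate_iff_of_galoisRel {Φ Ψ : CMType K} (h : (cmTypeGaloisSetoid K).r Φ Ψ) :
    IsNondegenerate Ψ ↔ IsNondegenerate Φ := by
  obtain ⟨τ, rfl⟩ := h
  exact isNondegenerate_cmTypeSmul_iff τ Φ

/-- **The rank is invariant under both equivalences at once**: `Rank(τ(Φσ)) = Rank(Φ)` (`τ ∈ Aut(ℂ)`, `σ ∈ Aut(K)`; the
«combined» equivalence of DIS Rem. 14; the twist half is the tree's `cmTypeRank_twist` / `Pohlmann1968.cmTypeRank_inducedCMType`, re-derived here from `typeRank_preimage_eq`). [cite: Dodson1987, §1.1 (p. 50)]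
[cite: DinaIonicaSijsling2022, §1.2 Rem. 14] -/
theorem cmTypeRank_cmTypeSmul_twist (τ : ℂ ≃+* ℂ) (σ : K ≃ₐ[ℚ] K) (Φ : CMType K) :
    cmTypeRank (cmTypeSmul τ (inducedCMType (σ.symm : K →+* K) Φ)) = cmTypeRank Φ := by
  rw [cmTypeRank_cmTypeSmul]
  -- `φ ↦ φ ∘ σ⁻¹` is an `Aut(ℂ)`-equivariant permutation of `Hom(K, ℂ)` with `Φσ` the preimage of `Φ`
  let f : (K →+* ℂ) ≃ (K →+* ℂ) :=
    { toFun := fun φ => φ.comp (σ.symm : K →+* K)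
      invFun := fun φ => φ.comp (σ : K →+* K)
      left_inv := fun φ => RingHom.ext fun x => by simp
      right_inv := fun φ => RingHom.ext fun x => by simp }
  change typeRank (ℂ ≃+* ℂ) (f ⁻¹' Φ.1) = typeRank (ℂ ≃+* ℂ) Φ.1
  exact typeRank_preimage_eq Φ.1 f (fun g => ⟨g, fun x' => RingHom.ext fun _ => rfl⟩)
    (fun g => ⟨g, fun x' => RingHom.ext fun _ => rfl⟩)

open Literature.AlgebraicGeometry.Motives in
/-- **Galois-equivalent CM types have the same Mumford–Tate Lie algebra `𝔪𝔱 ⊆ End_ℚ(K)`** (the rational Hodge tensors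
of `V¹_{(K,Φ)}` and `V¹_{(K,τΦ)}` coincide; tree `mumfordTateLieAlgebra_ofCMType_cmTypeSmul`). [cite: Deligne1982HodgeCycles, I Ex. 3.7]
[cite: DinaIonicaSijsling2022, §1.2 Def. 8 and Rem. 9] -/
theorem mumfordTateLieAlgebra_ofCMType_eq_of_galoisRel [HodgeTensorFacts.{0, 0}] {Φ Ψ : CMType K}
    (h : (cmTypeGaloisSetoid K).r Φ Ψ) :
    (HodgeStructure.ofCMType Ψ).mumfordTateLieAlgebra = (HodgeStructure.ofCMType Φ).mumfordTateLieAlgebra := by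
  obtain ⟨τ, rfl⟩ := h
  exact HodgeStructure.mumfordTateLieAlgebra_ofCMType_cmTypeSmul τ Φ

end Complex

/-! ## §3 Ribet's §3 in the complex model -/

section Ribet

open Literature.AlgebraicGeometry.Motives (CMType)
open Literature.AlgebraicGeometry.Motives.HodgeStructure (cmTypeSmul cmTypeSmul_val)
open Literature.AlgebraicGeometry.Pohlmann1968 (cmTypeRank IsNondegenerate isNondegenerate_iff cmTypeRank_le
  isCMTypeWith_conj isPretransitive_ringEquiv_complex)
open Literature.AlgebraicGeometry (GaoUllmo2025.galoisClosure GaoUllmo2025.corestrict)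

variable {K : Type} [Field K] [NumberField K] [IsCMField K]

/-- **`#(Aut(ℂ)·Φ) = [K* : ℚ]`**: the `Aut(ℂ)`-orbit of the set `Φ ⊆ Hom(K, ℂ)` is the Galois class of `Φ`, which has
`[ℚ(tr_Φ) : ℚ]` members (g24-#6). [cite: Shimura1998, §8.3 Prop. 28] [cite: Ribet1980, §3 (3.1) (p. 85)] -/
theorem natCard_orbit_eq_finrank_traceField (Φ : CMType K) :
    Nat.card (MulAction.orbit (ℂ ≃+* ℂ) Φ.1) = finrank ℚ (traceField Φ) := by
  rw [← natCard_galoisClass_eq_finrank_traceField Φ]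
  symm
  refine Nat.card_congr (Equiv.ofBijective
    (fun Ψ : {Ψ : CMType K // ∃ τ : ℂ ≃+* ℂ, Ψ = cmTypeSmul τ Φ} =>
      (⟨Ψ.1.1, by obtain ⟨τ, hτ⟩ := Ψ.2; exact MulAction.mem_orbit_iff.2 ⟨τ, by rw [hτ, cmTypeSmul_val]⟩⟩ :
        MulAction.orbit (ℂ ≃+* ℂ) Φ.1)) ⟨?_, ?_⟩)
  · intro Ψ Ψ' h
    have h1 : Ψ.1.1 = Ψ'.1.1 := congrArg (fun S : MulAction.orbit (ℂ ≃+* ℂ) Φ.1 => (S : Set (K →+* ℂ))) h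
    exact Subtype.ext (Subtype.ext h1)
  · rintro ⟨S, hS⟩
    obtain ⟨τ, rfl⟩ := MulAction.mem_orbit_iff.1 hS
    exact ⟨⟨cmTypeSmul τ Φ, τ, rfl⟩, Subtype.ext (cmTypeSmul_val τ Φ)⟩

/-- **Ribet (3.4) in `ℂ`: `Rank(Φ) ≤ [K* : ℚ]/2 + 1`** («`rank(E, S) ≤ min(d + 1, d′ + 1)`», the `d′`-half; the tree's
`IsCMTypeWith.typeRank_le_card_orbit` for `Aut(ℂ)` on `Hom(K, ℂ)`). [cite: Ribet1980, §3 (3.4) (p. 86)] -/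
theorem cmTypeRank_le_finrank_traceField_div_two_add_one (Φ : CMType K) :
    cmTypeRank Φ ≤ finrank ℚ (traceField Φ) / 2 + 1 := by
  haveI := isPretransitive_ringEquiv_complex (K := K)
  obtain ⟨φ₀⟩ := (inferInstance : Nonempty (K →+* ℂ))
  have h := (isCMTypeWith_conj Φ).typeRank_le_card_orbit φ₀
  rw [natCard_orbit_eq_finrank_traceField] at h
  exact h

/-- **Ribet (3.5) in `ℂ`, the reflex half: `2[K* : ℚ] ≤ 2^{Rank(Φ)}`** (i.e. `2 + log₂ n* ≤ Rank`), for EVERY CM type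
(the tree's Galois-side `two_mul_finrank_reflexField_le_two_pow_cmTypeRank` read in the Galois closure `K^c ⊂ ℂ`).
[cite: Ribet1980, §3 (3.5) (p. 87)] -/
theorem two_mul_finrank_traceField_le_two_pow_cmTypeRank (Φ : CMType K) :
    2 * finrank ℚ (traceField Φ) ≤ 2 ^ cmTypeRank Φ := by
  obtain ⟨φ₀⟩ := (inferInstance : Nonempty (K →+* ℂ))
  let Lc := GaoUllmo2025.galoisClosure K
  let j : K →ₐ[ℚ] Lc := GaoUllmo2025.corestrict K φ₀.toRatAlgHom
  let ι : Lc →+* ℂ := algebraMap Lc ℂ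
  rw [finrank_traceField_eq_finrank_reflexField j ι Φ]
  exact two_mul_finrank_reflexField_le_two_pow_cmTypeRank j ι Φ

/-- Integer form: `⌈log₂ 2[K* : ℚ]⌉ ≤ Rank(Φ)`. [cite: Ribet1980, §3 (3.5) (p. 87)] -/
theorem clog_two_mul_finrank_traceField_le_cmTypeRank (Φ : CMType K) :
    Nat.clog 2 (2 * finrank ℚ (traceField Φ)) ≤ cmTypeRank Φ :=
  Nat.clog_le_of_le_pow (two_mul_finrank_traceField_le_two_pow_cmTypeRank Φ)

/-- `Rank(Φ) ≥ 2` for every CM type of a CM field (`[K* : ℚ] ≥ 2`). [cite: Ribet1980, §3 (3.5) (p. 87)]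
[cite: Dodson1987, Thm. 1.0] -/
theorem two_le_cmTypeRank_complex (Φ : CMType K) : 2 ≤ cmTypeRank Φ := by
  have h := two_mul_finrank_traceField_le_two_pow_cmTypeRank Φ
  have h2 := two_le_finrank_traceField Φ
  by_contra hlt
  have hle : cmTypeRank Φ ≤ 1 := by omega
  have := Nat.pow_le_pow_right two_pos hle
  omega

/-- **Dodson's Thm. 1.4 (Ribet) through the reflex, in `ℂ`: an odd prime `p ∣ [K* : ℚ]` forces `p + 1 ≤ Rank(Φ)`.**
[cite: Dodson1987, Thm. 1.4 (pp. 51–52)] [cite: Ribet1980, §3 Prop. (3.3) (p. 86)] -/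
theorem add_one_le_cmTypeRank_of_prime_dvd_finrank_traceField (Φ : CMType K) {p : ℕ} (hp : p.Prime) (hp2 : p ≠ 2)
    (hdvd : p ∣ finrank ℚ (traceField Φ)) : p + 1 ≤ cmTypeRank Φ := by
  obtain ⟨φ₀⟩ := (inferInstance : Nonempty (K →+* ℂ))
  let Lc := GaoUllmo2025.galoisClosure K
  let j : K →ₐ[ℚ] Lc := GaoUllmo2025.corestrict K φ₀.toRatAlgHom
  let ι : Lc →+* ℂ := algebraMap Lc ℂ
  rw [finrank_traceField_eq_finrank_reflexField j ι Φ] at hdvd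
  exact add_one_le_cmTypeRank_of_prime_dvd_finrank_reflexField j ι Φ hp hp2 hdvd

/-- **Dodson's Thm. 1.12 through the reflex, in `ℂ`: `q² ∣ [K* : ℚ]` for an odd prime `q` forces `2q ≤ Rank(Φ)`.**
[cite: Dodson1987, Thm. 1.12 (pp. 54–55)] [cite: Ribet1980, §3 Prop. (3.3) (p. 86)] -/
theorem two_mul_le_cmTypeRank_of_prime_sq_dvd_finrank_traceField (Φ : CMType K) {q : ℕ} (hq : q.Prime) (hq2 : q ≠ 2)
    (hdvd : q ^ 2 ∣ finrank ℚ (traceField Φ)) : 2 * q ≤ cmTypeRank Φ := by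
  obtain ⟨φ₀⟩ := (inferInstance : Nonempty (K →+* ℂ))
  let Lc := GaoUllmo2025.galoisClosure K
  let j : K →ₐ[ℚ] Lc := GaoUllmo2025.corestrict K φ₀.toRatAlgHom
  let ι : Lc →+* ℂ := algebraMap Lc ℂ
  rw [finrank_traceField_eq_finrank_reflexField j ι Φ] at hdvd
  exact two_mul_le_cmTypeRank_of_prime_sq_dvd_finrank_reflexField j ι Φ hq hq2 hdvd

/-- **Ribet's Cor. (3.6) in `ℂ`: `[K* : ℚ] = 2^g` forces `Φ` to be nondegenerate.** [cite: Ribet1980, §3 Cor. (3.6) (p. 87)] -/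
theorem isNondegenerate_of_finrank_traceField_eq_two_pow (Φ : CMType K)
    (h : finrank ℚ (traceField Φ) = 2 ^ (finrank ℚ K / 2)) : IsNondegenerate Φ := by
  obtain ⟨φ₀⟩ := (inferInstance : Nonempty (K →+* ℂ))
  let Lc := GaoUllmo2025.galoisClosure K
  let j : K →ₐ[ℚ] Lc := GaoUllmo2025.corestrict K φ₀.toRatAlgHom
  let ι : Lc →+* ℂ := algebraMap Lc ℂ
  rw [finrank_traceField_eq_finrank_reflexField j ι Φ] at h
  exact isNondegenerate_of_finrank_reflexField_eq j ι Φ h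

/-- The two-sided squeeze `⌈log₂ 2[K* : ℚ]⌉ ≤ Rank(Φ) ≤ [K* : ℚ]/2 + 1`. [cite: Ribet1980, §3 (3.4)–(3.5) (pp. 86–87)] -/
theorem clog_le_cmTypeRank_and_le (Φ : CMType K) :
    Nat.clog 2 (2 * finrank ℚ (traceField Φ)) ≤ cmTypeRank Φ ∧ cmTypeRank Φ ≤ finrank ℚ (traceField Φ) / 2 + 1 :=
  ⟨clog_two_mul_finrank_traceField_le_cmTypeRank Φ, cmTypeRank_le_finrank_traceField_div_two_add_one Φ⟩

end Ribet

/-! ## §4 Small reflex degrees determine the rank: `2 ↔ 2`, `4 ↔ 3`, `6 → 4`, `12 → ≥ 5` -/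

section Small

open Literature.AlgebraicGeometry.Motives (CMType)
open Literature.AlgebraicGeometry.Pohlmann1968 (cmTypeRank IsNondegenerate isNondegenerate_iff cmTypeRank_le)

variable {K : Type} [Field K] [NumberField K] [IsCMField K]

/-- **`Rank(Φ) = 2 ⟺ [K* : ℚ] = 2`** ((3.4): `[K* : ℚ] = 2 ⟹ Rank ≤ 2`; (3.5): `Rank = 2 ⟹ 2[K* : ℚ] ≤ 4`).
[cite: Ribet1980, §3 (3.4)–(3.5) (pp. 86–87)] -/
theorem cmTypeRank_eq_two_iff_finrank_traceField_eq_two (Φ : CMType K) :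
    cmTypeRank Φ = 2 ↔ finrank ℚ (traceField Φ) = 2 := by
  have h1 := cmTypeRank_le_finrank_traceField_div_two_add_one Φ
  have h2 := two_mul_finrank_traceField_le_two_pow_cmTypeRank Φ
  have h3 := two_le_cmTypeRank_complex Φ
  have h4 := two_le_finrank_traceField Φ
  constructor
  · intro hr
    rw [hr] at h2
    norm_num at h2
    omega
  · intro hf
    rw [hf] at h1
    norm_num at h1
    omega

/-- **`Rank(Φ) = 2 ⟺ Φ` is induced from an imaginary quadratic subfield** (g25-#3: `[K* : ℚ] = 2 ⟺` induced from an
imaginary quadratic subfield; such a type has only the two translates `Φ, Φ̄`). [cite: Ribet1980, §3 (3.4)–(3.5)]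
[cite: Shimura1998, §8.4 Example (2)(A)] [cite: Dodson1987, §1.1 (p. 50)] -/
theorem cmTypeRank_eq_two_iff_exists_inducedCMType_quadratic (Φ : CMType K) :
    cmTypeRank Φ = 2 ↔
      ∃ (k : IntermediateField ℚ K) (Ψ : CMType k), finrank ℚ k = 2 ∧ inducedCMType (algebraMap k K) Ψ = Φ := by
  rw [cmTypeRank_eq_two_iff_finrank_traceField_eq_two, finrank_traceField_eq_two_iff_exists_inducedCMType_quadratic]

/-- **`Rank(Φ) = 3 ⟺ [K* : ℚ] = 4`** ((3.4): `4 ↦ ≤ 3`; (3.5): `Rank = 3 ⟹ [K* : ℚ] ≤ 4`, and `≠ 2` by the previous).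
[cite: Ribet1980, §3 (3.4)–(3.5) (pp. 86–87)] -/
theorem cmTypeRank_eq_three_iff_finrank_traceField_eq_four (Φ : CMType K) :
    cmTypeRank Φ = 3 ↔ finrank ℚ (traceField Φ) = 4 := by
  have h1 := cmTypeRank_le_finrank_traceField_div_two_add_one Φ
  have h2 := two_mul_finrank_traceField_le_two_pow_cmTypeRank Φ
  have h22 := cmTypeRank_eq_two_iff_finrank_traceField_eq_two Φ
  have h4 := two_le_finrank_traceField Φ
  obtain ⟨m, hm⟩ := two_dvd_finrank_traceField Φ
  constructor
  · intro hr
    rw [hr] at h2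
    norm_num at h2
    have hne : finrank ℚ (traceField Φ) ≠ 2 := fun h => by
      have := h22.2 h
      omega
    omega
  · intro hf
    rw [hf] at h1
    norm_num at h1
    have hne : cmTypeRank Φ ≠ 2 := fun h => by
      have := h22.1 h
      omega
    have h8 : 2 * 4 ≤ 2 ^ cmTypeRank Φ := hf ▸ h2
    by_contra hne3
    have hle : cmTypeRank Φ ≤ 2 := by omega
    have := Nat.pow_le_pow_right two_pos hle
    omega

/-- **`Rank(Φ) = 3 ⟺` the primitive core of `Φ` is a QUARTIC field** (g25-#3 `finrank_traceField_eq_four_iff_exists_quartic_core`).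
[cite: Ribet1980, §3 (3.4)–(3.5)] [cite: Shimura1998, §8.4 Example (2)(B)–(C)] -/
theorem cmTypeRank_eq_three_iff_exists_quartic_core (Φ : CMType K) :
    cmTypeRank Φ = 3 ↔
      ∃ (K₁ : IntermediateField ℚ K) (Φ₁ : CMType K₁), finrank ℚ K₁ = 4 ∧
        inducedCMType (algebraMap K₁ K) Φ₁ = Φ ∧ ∀ s₀ : K₁ →+* ℂ, IsPrimitive (ℂ ≃+* ℂ) Φ₁.1 s₀ := by
  rw [cmTypeRank_eq_three_iff_finrank_traceField_eq_four, finrank_traceField_eq_four_iff_exists_quartic_core]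

/-- **`[K* : ℚ] = 6 ⟹ Rank(Φ) = 4`** ((3.4): `≤ 4`; (3.5): `12 ≤ 2^{Rank}`; also `3 ∣ 6` and Dodson Thm. 1.4).
[cite: Ribet1980, §3 (3.4)–(3.5) (pp. 86–87)] [cite: Dodson1987, Thm. 1.4] -/
theorem cmTypeRank_eq_four_of_finrank_traceField_eq_six (Φ : CMType K) (h6 : finrank ℚ (traceField Φ) = 6) :
    cmTypeRank Φ = 4 := by
  have h1 := cmTypeRank_le_finrank_traceField_div_two_add_one Φ
  have h2 := add_one_le_cmTypeRank_of_prime_dvd_finrank_traceField Φ Nat.prime_three (by norm_num)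
    (by rw [h6]; norm_num)
  rw [h6] at h1
  norm_num at h1
  omega

/-- `[K* : ℚ] = 8 ⟹ Rank(Φ) ∈ {4, 5}`. [cite: Ribet1980, §3 (3.4)–(3.5) (pp. 86–87)] -/
theorem cmTypeRank_mem_of_finrank_traceField_eq_eight (Φ : CMType K) (h8 : finrank ℚ (traceField Φ) = 8) :
    cmTypeRank Φ = 4 ∨ cmTypeRank Φ = 5 := by
  have h1 := cmTypeRank_le_finrank_traceField_div_two_add_one Φ
  have h2 := two_mul_finrank_traceField_le_two_pow_cmTypeRank Φ
  rw [h8] at h1 h2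
  norm_num at h1
  by_contra hne
  have hle : cmTypeRank Φ ≤ 3 := by omega
  have := Nat.pow_le_pow_right two_pos hle
  omega

/-- `[K* : ℚ] = 12 ⟹ 5 ≤ Rank(Φ) ≤ 7` ((3.5): `24 ≤ 2^{Rank}`). [cite: Ribet1980, §3 (3.4)–(3.5) (pp. 86–87)] -/
theorem five_le_cmTypeRank_of_finrank_traceField_eq_twelve (Φ : CMType K) (h12 : finrank ℚ (traceField Φ) = 12) :
    5 ≤ cmTypeRank Φ ∧ cmTypeRank Φ ≤ 7 := by
  have h1 := cmTypeRank_le_finrank_traceField_div_two_add_one Φ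
  have h2 := two_mul_finrank_traceField_le_two_pow_cmTypeRank Φ
  rw [h12] at h1 h2
  norm_num at h1
  refine ⟨?_, h1⟩
  by_contra hlt
  have hle : cmTypeRank Φ ≤ 4 := by omega
  have := Nat.pow_le_pow_right two_pos hle
  omega

/-- **A PRIMITIVE type of a CM field of degree `≥ 4` has `Rank ≥ 3`** (its reflex degree is `≥ 4`, g25-#3, and (3.5);
Yanai's Prop. A (c) in the tree is the group-level form). [cite: Ribet1980, §3 (3.2) and (3.5)] [cite: Yanai1985, §2 Prop. A (c)] -/
theorem three_le_cmTypeRank_of_isPrimitive (h4 : 4 ≤ finrank ℚ K) {Φ : CMType K} {φ₀ : K →+* ℂ}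
    (hprim : IsPrimitive (ℂ ≃+* ℂ) Φ.1 φ₀) : 3 ≤ cmTypeRank Φ := by
  have hr := four_le_finrank_traceField_of_isPrimitive h4 hprim
  have h2 := two_mul_finrank_traceField_le_two_pow_cmTypeRank Φ
  by_contra hlt
  have hle : cmTypeRank Φ ≤ 2 := by omega
  have := Nat.pow_le_pow_right two_pos hle
  omega

end Small

/-! ## §5 Degree instances: sextic, octic, decic -/

section Instances

open Literature.AlgebraicGeometry.Motives (CMType)
open Literature.AlgebraicGeometry.Pohlmann1968 (cmTypeRank IsNondegenerate isNondegenerate_iff cmTypeRank_le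
  isNondegenerate_of_isPrimitive_of_prime)

variable {K : Type} [Field K] [NumberField K] [IsCMField K]

/-- **Sextic CM field: every CM type has rank `2` (imprimitive, reflex degree `2`) or `4` (primitive, nondegenerate —
Yanai / Ribet for the prime dimension `3`).** [cite: Yanai1985, §4 Theorem] [cite: Ribet1980, §3 (3.4)–(3.5)]
[cite: Dodson1987, Thm. 1.0 (v)] -/
theorem cmTypeRank_eq_two_or_four_of_finrank_eq_six (h6 : finrank ℚ K = 6) (Φ : CMType K) :
    cmTypeRank Φ = 2 ∨ cmTypeRank Φ = 4 := by
  obtain ⟨φ₀⟩ := (inferInstance : Nonempty (K →+* ℂ))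
  by_cases h : IsPrimitive (ℂ ≃+* ℂ) Φ.1 φ₀
  · right
    have hnd := isNondegenerate_of_isPrimitive_of_prime Nat.prime_three h6 φ₀ h
    rw [isNondegenerate_iff, h6] at hnd
    exact hnd
  · left
    exact (cmTypeRank_eq_two_iff_finrank_traceField_eq_two Φ).2
      (finrank_traceField_eq_two_of_not_isPrimitive_of_finrank_eq_six h6 h)

/-- Sextic: `Rank(Φ) = 4 ⟺ Φ` primitive `⟺ [K* : ℚ] ≥ 6`; `Rank(Φ) = 2 ⟺` imprimitive `⟺ [K* : ℚ] = 2`.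
[cite: Yanai1985, §4 Theorem] [cite: Ribet1980, §3 (3.2), (3.4)–(3.5)] -/
theorem cmTypeRank_eq_four_iff_isPrimitive_sextic (h6 : finrank ℚ K = 6) (Φ : CMType K) (φ₀ : K →+* ℂ) :
    cmTypeRank Φ = 4 ↔ IsPrimitive (ℂ ≃+* ℂ) Φ.1 φ₀ := by
  rw [isPrimitive_iff_finrank_traceField_ne_two h6 Φ φ₀, Ne, ← cmTypeRank_eq_two_iff_finrank_traceField_eq_two]
  rcases cmTypeRank_eq_two_or_four_of_finrank_eq_six h6 Φ with h | h <;> omega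

/-- Sextic: every PRIMITIVE type is nondegenerate, every imprimitive one degenerate of rank `2`.
[cite: Yanai1985, §4 Theorem] [cite: Dodson1987, Thm. 1.0 (v)] -/
theorem isNondegenerate_iff_isPrimitive_sextic (h6 : finrank ℚ K = 6) (Φ : CMType K) (φ₀ : K →+* ℂ) :
    IsNondegenerate Φ ↔ IsPrimitive (ℂ ≃+* ℂ) Φ.1 φ₀ := by
  rw [isNondegenerate_iff, h6, ← cmTypeRank_eq_four_iff_isPrimitive_sextic h6 Φ φ₀]

/-- **Octic CM field: a type of reflex degree `12` or `16` is NONDEGENERATE** (`Rank ≥ 5 = 4 + 1` by (3.5), resp. Cor.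
(3.6); Kubota `Rank ≤ 5`). [cite: Ribet1980, §3 (3.5) and Cor. (3.6) (p. 87)] [cite: Dodson1987, Thm. 1.0 (ii)] -/
theorem isNondegenerate_of_twelve_le_finrank_traceField_octic (h8 : finrank ℚ K = 8) (Φ : CMType K)
    (h12 : 12 ≤ finrank ℚ (traceField Φ)) : IsNondegenerate Φ := by
  have h2 := two_mul_finrank_traceField_le_two_pow_cmTypeRank Φ
  have hle := cmTypeRank_le Φ
  rw [h8] at hle
  norm_num at hle
  rw [isNondegenerate_iff, h8]
  norm_num
  by_contra hne
  have hle4 : cmTypeRank Φ ≤ 4 := by omega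
  have := Nat.pow_le_pow_right two_pos hle4
  omega

/-- **Octic rank table by reflex degree**: `[K* : ℚ] = 2 ↦ Rank 2`, `4 ↦ 3`, `6 ↦ 4`, `8 ↦ 4 or 5`, `12 ↦ 5`, `16 ↦ 5`
(reflex degrees `∈ {2, 4, 6, 8, 12, 16}`, g25-#4); in particular a DEGENERATE PRIMITIVE octic type has reflex degree
`6` or `8` and rank `4`. [cite: Ribet1980, §3 (3.4)–(3.5), Cor. (3.6)] [cite: Dodson1987, Thm. 1.0 (ii), (iv)] -/
theorem cmTypeRank_eq_four_of_isPrimitive_of_not_isNondegenerate_octic (h8 : finrank ℚ K = 8) {Φ : CMType K}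
    {φ₀ : K →+* ℂ} (hprim : IsPrimitive (ℂ ≃+* ℂ) Φ.1 φ₀) (hdeg : ¬ IsNondegenerate Φ) :
    cmTypeRank Φ = 4 ∧ (finrank ℚ (traceField Φ) = 6 ∨ finrank ℚ (traceField Φ) = 8) := by
  have hle := cmTypeRank_le Φ
  rw [isNondegenerate_iff, h8] at hdeg
  rw [h8] at hle
  norm_num at hdeg hle
  rcases finrank_traceField_mem_of_isPrimitive_octic h8 hprim with h | h | h | h
  · exact ⟨cmTypeRank_eq_four_of_finrank_traceField_eq_six Φ h, Or.inl h⟩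
  · refine ⟨?_, Or.inr h⟩
    rcases cmTypeRank_mem_of_finrank_traceField_eq_eight Φ h with h' | h'
    · exact h'
    · exact absurd h' hdeg
  · exfalso
    have := isNondegenerate_of_twelve_le_finrank_traceField_octic h8 Φ (by rw [h])
    rw [isNondegenerate_iff, h8] at this
    exact hdeg this
  · exfalso
    have := isNondegenerate_of_twelve_le_finrank_traceField_octic h8 Φ (by rw [h]; norm_num)
    rw [isNondegenerate_iff, h8] at this
    exact hdeg this

/-- Octic: the rank of a CM type is `2, 3, 4` or `5`, and `Rank = 3 ⟺` induced from a primitive type of a quartic CM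
subfield. [cite: Ribet1980, §3 (3.4)–(3.5)] [cite: Dodson1987, Thm. 1.0 (ii), (iv)] -/
theorem cmTypeRank_mem_of_finrank_eq_eight (h8 : finrank ℚ K = 8) (Φ : CMType K) :
    cmTypeRank Φ = 2 ∨ cmTypeRank Φ = 3 ∨ cmTypeRank Φ = 4 ∨ cmTypeRank Φ = 5 := by
  have hle := cmTypeRank_le Φ
  have h2 := two_le_cmTypeRank_complex Φ
  rw [h8] at hle
  norm_num at hle
  omega

/-- **Degree `10`: every CM type has rank `2` (imprimitive) or `6` (primitive: nondegenerate, Yanai for `p = 5`).**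
[cite: Yanai1985, §4 Theorem] [cite: Dodson1987, Thm. 1.0 (v)] [cite: Ribet1980, §3 (3.4)–(3.5)] -/
theorem cmTypeRank_eq_two_or_six_of_finrank_eq_ten (h10 : finrank ℚ K = 10) (Φ : CMType K) :
    cmTypeRank Φ = 2 ∨ cmTypeRank Φ = 6 := by
  obtain ⟨φ₀⟩ := (inferInstance : Nonempty (K →+* ℂ))
  by_cases h : IsPrimitive (ℂ ≃+* ℂ) Φ.1 φ₀
  · right
    have hnd := isNondegenerate_of_isPrimitive_of_prime Nat.prime_five h10 φ₀ h
    rw [isNondegenerate_iff, h10] at hnd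
    exact hnd
  · left
    exact (cmTypeRank_eq_two_iff_finrank_traceField_eq_two Φ).2
      ((not_isPrimitive_iff_finrank_traceField_eq_two_of_prime Nat.prime_five h10 Φ φ₀).1 h)

end Instances

end Literature.NumberTheory.ComplexMultiplication
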